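import Literature.NumberTheory.GaloisRepresentations.SerreWeight
import Literature.NumberTheory.Automorphic.BCDTModularity
import Literature.NumberTheory.EllipticCurves.KellerYin2024.PotentiallyGoodOrdinaryPConverse
import Literature.NumberTheory.EllipticCurves.Rank1Residual.Predicates
import Literature.NumberTheory.EllipticCurves.GlobalMinimalModel
import HarnessLib

/-!
# Kraus 1997 (Dissertationes Math. 364), Proposition 1: the action of inertia on `E[p]` at an ADDITIVE
# potentially good prime `p ≥ 5` when the good model over `ℚ_p(p^{v(Δ)/12})` is ORDINARY —
# `(χ^{1−α} ∗; 0 χ^α)` with `α = (p − 1)v(Δ)/12`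

Topic `Literature/NumberTheory/EllipticCurves`, namespace `Literature.NumberTheory.EllipticCurves.Kraus1997` (companion of
`PTorsionInertiaPotentiallyGood.lean`, which vendors Prop. 2 = the supersingular case `h = 2`).  ONE NAMED FACT
(`def … : Prop`, D-0014: a published theorem cited to the page that proves it, asserted nowhere, no `sorry`, no instance, no
notation), typed WITH the inertia characters, in the tree's Serre-recipe vocabulary
(`ModPGaloisRep.LocalRestrictionAt`, `ModPGaloisRep.HasLevelOneInertiaShape`, `WeierstrassCurve.IsTorsionGaloisRep`).

## Citation header (read by this seat, 2026-08-30, pp. 8–11 of the DML-PL copy)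

* A. Kraus, *Détermination du poids et du conducteur associés aux représentations des points de `p`-torsion d'une courbe
  elliptique*, Dissertationes Math. **364** (1997); DML-PL `rm36401.pdf` (printed page = PDF page + 1; seat store key
  `paper:url-e1e0b76bb96f`). Bib key `Kraus1997Dissertationes`.
* Standing hypotheses of §I.B.1 (p. 8): `p ≥ 5`; `E/ℚ_p` with ADDITIVE reduction and `v(j) ≥ 0`; `c₄, c₆, Δ` the invariants of a
  minimal model; `L = ℚ_p(p^{v(Δ)/12})`, over which the model `E_L` has good reduction; `h ∈ {1, 2}` the height of the formal group
  of `E_L` — "`h = 1` si `E_L` est à réduction ordinaire et `h = 2` si `E_L` est à réduction supersingulière"; `I ⊂ Gal(ℚ̄_p/ℚ_p)` the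
  inertia group, `E_p = E[p](ℚ̄_p)`, `χ_α` Serre's characters of `I`, `χ = χ_{1/(p−1)}` (the mod-`p` cyclotomic character on `I`,
  Serre's fundamental character of level one).
* Verbatim (§I.B.1 no. 2.3.1, p. 9): **Proposition 1.** «Lorsque `h = 1`, le nombre `α = (p − 1)v(Δ)/12` est entier et la
  représentation de `I` dans `E_p` s'écrit matriciellement `(χ^{1−α} ∗ ; 0 χ^α)` dans une base convenable de `E_p` sur `𝔽_p`.»
  (Proof, pp. 9–10: the kernel `C_p` of reduction `E_p → Ẽ_{L,p}` is a `G_p`-stable line on which `I` acts by `χ^{1−α}`; the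
  determinant is `χ`, so `I` acts on `E_p/C_p` by `χ^α`.)

## Hypotheses, enumerated (word for word → tree predicate)

1. "`E` définie sur `ℚ_p`" — SPECIAL CASE typed: `E = W ⊗ ℚ_p` for `W : WeierstrassCurve ℚ`, `[W.IsElliptic]`.
   -- TODO(general form): an arbitrary elliptic curve over `ℚ_p` with a `p`-minimal model.
2. "`p ≥ 5`" — `5 ≤ p`.  3. "réduction de type additif" — `Rank1Residual.Addv W p`.
4. "`v(j) ≥ 0`" and "`h = 1`" — `W.HasPotentiallyGoodOrdinaryReductionAtPrime p` (potentially good reduction with ORDINARY special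
   fibre; Kraus's `h` is the height of the reduction of the good model `E_L`, and ordinarity does not depend on the field over which
   good reduction is attained, `KellerYin2024.PotentiallyGoodOrdinaryPConverse`).
5. "`Δ` d'un modèle minimal" — `[W.IsGloballyMinimal]`, `v(Δ) = padicValInt p W.minimalDiscriminantInt`.
6. "la représentation de `I` dans `E_p`" — any framed model `ρ̄ : Γ_ℚ → GL₂(𝔽_p)` of `E[p]` (`W.IsTorsionGaloisRep p ρ̄`), base
   changed along a continuous `j : 𝔽_p → k`, restricted to `Γ_{ℚ_p}` through any local restriction datum
   `loc : LocalRestrictionAt p (ρ̄ ⊗_j k)` (the tree's stand-in for the decomposition group at `p`, `SerreWeight.lean`).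
7. "`(χ^{1−α} ∗ ; 0 χ^α)`" — `loc.rep.HasLevelOneInertiaShape ι p _ (p − α) α`: `χ = fundamentalCharacter loc.F 1 ι p _` is the
   level-one fundamental character (= `χ_{1/(p−1)}`, the cyclotomic character on inertia; `ϖ = p` is a uniformiser of `𝒪[loc.F]`),
   the FIRST exponent is the character on the stable line, and `χ^{1−α} = χ^{p−α}` because `χ` has order `p − 1`
   (`fundamentalCharacter_one_pow_eq_one`) and `α ≤ 10(p−1)/12 < p`; the `∗` is the (possibly wild) off-diagonal entry allowed by
   `HasLevelOneInertiaShape`.  `α = (p − 1)·v(Δ)/12` is typed with natural-number division (Kraus: «le nombre `α` est entier»).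

Companion statements NOT vendored here: Prop. 2 (`h = 2`; `PTorsionInertiaPotentiallyGood.lean`), Prop. 4 (when `∗` is wild,
p. 14), Théorème 1 (Serre's weight at every additive `p ≥ 5`, pp. 6–7).  Consumer: route BSD/TeichmullerTwistDescent, crux
`TwistedPeriodLatticeSaturation` (stmt-BirchSwinnertonDyer-25368), input (W‴) `NoEtaleWeightEigenQuotient` (the Serre-weight exclusion
`Sym^{2b} ⊗ det^{−b} ∉ W(ρ̄_W)`; on the unstarred Kodaira types II/III/IV, `v(Δ) ∈ {2,3,4}`, `α = b = tameExponent p W`).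
No `_holds` is to be expected soon (formal groups over `ℚ_p(p^{1/e})`, Serre's `χ_α`); consumers take
`(h : propOne_inertiaShape_of_ordinary)`.  D-0026: exactly ONE named fact, nothing else minted.
-/

noncomputable section

open scoped Classical Valued
open ValuativeRel

open WeierstrassCurve Literature.NumberTheory.EllipticCurves Literature.NumberTheory.EllipticCurves.Rank1Residual
open Literature.NumberTheory.GaloisRepresentations Literature.NumberTheory.Automorphic
open Literature.NumberTheory.GaloisRepresentations.IsNonarchimedeanLocalField

namespace Literature.NumberTheory.EllipticCurves.Kraus1997

/-- **Kraus, Dissertationes Math. 364 (1997), Proposition 1 (§I.B.1 no. 2.3.1, p. 9).**  Let `p ≥ 5` be prime and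
`E = W ⊗ ℚ_p` for an elliptic curve `W/ℚ` given by a globally minimal equation, with ADDITIVE reduction at `p` and potentially good
ORDINARY reduction at `p` (Kraus's `h = 1`: the good model over `ℚ_p(p^{v(Δ)/12})` has ordinary reduction).  Put
`α = (p − 1)·v_p(Δ_min)/12` (an integer).  Then in a suitable basis of `E[p]` the inertia group at `p` acts by
`(χ^{1−α} ∗ ; 0 χ^α)`, `χ` the mod-`p` cyclotomic character (= Serre's level-one fundamental character): for every framed model
`ρ̄` of `E[p]` (`W.IsTorsionGaloisRep p ρ̄`), every continuous `j : 𝔽_p → k`, every local restriction datum `loc` of `ρ̄ ⊗_j k` at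
`p` and every residue embedding `ι`, `loc.rep.HasLevelOneInertiaShape ι p _ (p − α) α` (`χ^{p−α} = χ^{1−α}`, `χ` having order
`p − 1`; the first exponent is the character on the stable line `C_p` = kernel of reduction).  Special case (base changes of global
minimal curves) of the printed local statement. [cite: Kraus1997Dissertationes, Prop. 1 (p. 9), §I.B.1 no. 2.1–2.3 (pp. 8–10)] -/
def propOne_inertiaShape_of_ordinary : Prop :=
  ∀ (p : ℕ) [Fact p.Prime], 5 ≤ p →
    ∀ (W : WeierstrassCurve ℚ) [W.IsElliptic] [W.IsGloballyMinimal],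
      Addv W p → W.HasPotentiallyGoodOrdinaryReductionAtPrime p →
      ∀ (ρ : ModPGaloisRep ℚ (ZMod p) 2), W.IsTorsionGaloisRep p ρ →
      ∀ (k : Type) [Field k] [TopologicalSpace k] [IsTopologicalRing k] (j : ZMod p →+* k) (hj : Continuous j)
        (loc : ModPGaloisRep.LocalRestrictionAt p (FramedRep.baseChange j hj ρ))
        (ι : absIntegers 𝒪[loc.F] loc.F ⧸ absMaximalIdeal loc.F →+* k),
        loc.rep.HasLevelOneInertiaShape ι ((p : ℕ) : 𝒪[loc.F]) loc.irreducible_natCast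
          (p - (p - 1) * padicValInt p W.minimalDiscriminantInt / 12)
          ((p - 1) * padicValInt p W.minimalDiscriminantInt / 12)

end Literature.NumberTheory.EllipticCurves.Kraus1997
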